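import Mathlib
import Summits.NavierStokesRegularity.NavierStokesRegularity.Theorems.EulerZoomLiouvillePowerGaugeEulerLiouvilleFadingTamePastTools
import Summits.NavierStokesRegularity.NavierStokesRegularity.Theorems.EulerZoomLiouvillePowerGaugeEulerLiouvilleFadingTamePast
import HarnessLib.Audit

/-!
# Crux E `PowerGaugeEulerLiouville` (stmt-NavierStokesRegularity-19832): classical members with an EXPONENTIALLY FADING PAST,
# a BOUNDED (not tame) gradient and STEEPLY DECAYING VORTICITY are irrotational, hence trivial

Route `EulerZoomLiouville` (NavierStokesRegularity), crux E = Seregin's power-gauged ancient-Euler Liouville statement.  A CLASSICAL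
stratum next to the LEAD's `…FadingTamePast` (line `logtime-breathers`, T2b): a classical Euler solution `(u, p)` on a past sub-slab
`(−∞, T₁)` with
* FADING velocity `‖u(t, y)‖ ≤ M e^{ct}` (`c > 0`),
* a merely BOUNDED gradient `‖∇u(t, y)‖ ≤ C` (the tame decay `(1 + e^{−ct}‖y‖)^{−(1+ε)}` of T2b is NOT assumed), and
* STEEP VORTICITY DECAY in the breathing variable, `‖curl u(t, y)‖ ≤ D (1 + e^{−ct}‖y‖)^{−k}` with `k c > C`,
is IRROTATIONAL on `(−∞, T₁)` (`FadingSteepPast.curl_eq_zero`), and a member of the class with such a past (`T₁ ≤ 0`) is trivial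
(`FadingSteepPast.ae_eq_zero_of_gauge_of_fadingSteepVorticityPast`, via the tree's `PastIrrotational.ae_eq_zero_of_gauge_of_pastIrrotational`).
This is a bite out of the residue T3 ("wild breathers") of line `logtime-breathers`; the breather corollary
(`u = e^{cτ}V(e^{−cτ}y)`, `V` bounded, `‖∇V‖ ≤ C`, `‖curl V(z)‖ ≤ D(1+‖z‖)^{−k}`, `k c > C`) is the sequel `…LogtimeBreatherSteepVorticity`.

MECHANISM (the LEAD's T2b frame with a CONSTANT stretching rate).  Fix `τ < T₁`, `x`, follow the particle `P(r) = φ(r, τ, x)` backward.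
Finite displacement (`FadingPast.norm_evolutionMap_sub_le`): either the particle is TRAPPED (`‖P(r)‖ ≤ (M/c)e^{cr}` for all `r ≤ τ`;
the trapped set is closed and NULL, `FadingPast.isClosed_trapped` / `FadingPast.volume_trapped_eq_zero`), or from some time `r₁ ≤ τ` on
(backward) it stays at distance `≥ δ > 0` from the origin.  There the two-time Cauchy formula with the crude Grönwall bound
`‖∇φ(r₁, σ, ·)(P(σ))‖ ≤ e^{C(r₁−σ)}` (`FadingPast.norm_curl_le_exp_integral_path` with the constant rate `C`) and the steep source
`‖ω(σ, P(σ))‖ ≤ D (e^{−cσ}δ)^{−k} = D δ^{−k} e^{kcσ}` give `‖ω(r₁, P(r₁))‖ ≤ D δ^{−k} e^{C r₁} · e^{(kc − C)σ} → 0` as `σ → −∞`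
BECAUSE `kc > C` (`curl_eq_zero_of_escape`); the Cauchy formula from `r₁` to `τ` transports the zero
(`FadingPast.curl_eq_zero_of_curl_eq_zero_earlier`).  So `curl u(τ) = 0` off a closed null set, hence everywhere by continuity.

WHAT THIS IS NOT: not NS regularity, not the crux E — one more classical stratum (a statement about a hypothetical Euler zoom-limit
class) for the lead skeleton `Cruxes/PowerGaugeEulerLiouville/Lines/birth.lean` (interim LEAD ns-typeII-p2 g10; width seat ns-cas-k2 g0),
`--supports stmt-NavierStokesRegularity-19832 --as helper`. [folklore; MajdaBertozziCUP2002 §1.6 Prop 1.8 (1.51), §2.5 (2.115)–(2.117),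
§4.2 (4.46)–(4.47)]
-/

noncomputable section

set_option linter.dupNamespace false

open MeasureTheory Set Filter Topology Metric Function
open scoped NNReal ENNReal ContDiff

namespace Summit.NavierStokesRegularity.NavierStokesRegularity.Theorems.PowerGaugeEulerLiouville.FadingSteepPast

open Literature.Analysis Literature.Analysis.FluidPDE
open Summit.NavierStokesRegularity.NavierStokesRegularity.Theorems.PowerGaugeEulerLiouville.FadingPast

section Fading

variable {u : ℝ → EuclideanSpace ℝ (Fin 3) → EuclideanSpace ℝ (Fin 3)} {p : ℝ → EuclideanSpace ℝ (Fin 3) → ℝ}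
  {T₁ c M C D k : ℝ}

/-- A uniform gradient bound `‖∇u‖ ≤ C` on `(−∞, T₁)` makes `C ≥ 0`, every slice `C`-Lipschitz, and the Cauchy–Lipschitz
hypotheses hold on `(−∞, T₁)`. [folklore] -/
theorem lipschitz_and_isUniformlyLipschitzOn (hcl : IsClassicalEulerSolutionOn (Iio T₁) 0 u p)
    (hgrad : ∀ s : ℝ, s < T₁ → ∀ y, ‖fderiv ℝ (u s) y‖ ≤ C) :
    0 ≤ C ∧ ∃ K : ℝ≥0, (∀ s : ℝ, s < T₁ → LipschitzWith K (u s)) ∧ ODE.IsUniformlyLipschitzOn u (Iio T₁) := by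
  have hC0 : 0 ≤ C := by
    obtain ⟨s, hs⟩ := exists_lt T₁
    exact (norm_nonneg _).trans (hgrad s hs 0)
  refine ⟨hC0, ⟨C, hC0⟩, fun s hs => ?_, ?_⟩
  · refine lipschitzWith_of_nnnorm_fderiv_le ((hcl.contDiff_velocity hs).differentiable (by simp)) fun y => ?_
    have h : (‖fderiv ℝ (u s) y‖₊ : ℝ) ≤ C := by rw [coe_nnnorm]; exact hgrad s hs y
    exact_mod_cast h
  · exact hcl.smooth_velocity.isUniformlyLipschitzOn_of_norm_fderiv_le fun K _ hKS =>
      ⟨C, fun s hs y => hgrad s (hKS hs) y⟩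

/-- **KILL ALONG AN ESCAPED TRAJECTORY (steep vorticity, bounded gradient).**  If the particle sitting at `x₁` at time `r₁ < T₁`
stays at distance `≥ δ > 0` from the origin at all earlier times, then `ω(r₁, x₁) = 0`: the Cauchy formula from `σ` to `r₁` with the
constant stretching rate `C` and the steep source `‖ω(σ, φ(σ, r₁, x₁))‖ ≤ D δ^{−k} e^{kcσ}` gives
`‖ω(r₁, x₁)‖ ≤ (D δ^{−k} e^{C r₁}) e^{(kc − C)σ} → 0` as `σ → −∞`, since `kc > C`. [folklore; MajdaBertozziCUP2002 §2.5 (2.117), §4.2 (4.47)] -/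
theorem curl_eq_zero_of_escape (hcl : IsClassicalEulerSolutionOn (Iio T₁) 0 u p) (hc : 0 < c)
    (hgrad : ∀ s : ℝ, s < T₁ → ∀ y, ‖fderiv ℝ (u s) y‖ ≤ C)
    (hcurl : ∀ s : ℝ, s < T₁ → ∀ y, ‖curl (u s) y‖ ≤ D * (1 + Real.exp (-(c * s)) * ‖y‖) ^ (-k))
    (hkc : C < k * c) {r₁ : ℝ} (hr₁ : r₁ < T₁) (x₁ : EuclideanSpace ℝ (Fin 3)) {δ : ℝ} (hδ : 0 < δ)
    (hfar : ∀ r : ℝ, r ≤ r₁ → δ ≤ ‖ODE.evolutionMap u r₁ r x₁‖) :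
    curl (u r₁) x₁ = 0 := by
  obtain ⟨hC0, K, hK, hL⟩ := lipschitz_and_isUniformlyLipschitzOn hcl hgrad
  have hk0 : 0 < k := by
    by_contra hk
    push Not at hk
    have : k * c ≤ 0 := mul_nonpos_of_nonpos_of_nonneg hk hc.le
    linarith
  have hD0 : 0 ≤ D := by
    have h := hcurl r₁ hr₁ 0
    rw [norm_zero, mul_zero, add_zero, Real.one_rpow, mul_one] at h
    exact (norm_nonneg _).trans h
  -- the steep source at a point of norm `≥ δ`: `‖ω(s, y)‖ ≤ D δ^{-k} e^{k c s}`
  set D' : ℝ := D * δ ^ (-k) with hD'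
  have hD'0 : 0 ≤ D' := mul_nonneg hD0 (Real.rpow_nonneg hδ.le _)
  have hsteep : ∀ s : ℝ, s < T₁ → ∀ y : EuclideanSpace ℝ (Fin 3), δ ≤ ‖y‖ →
      ‖curl (u s) y‖ ≤ D' * Real.exp (k * c * s) := by
    intro s hs y hy
    refine (hcurl s hs y).trans ?_
    have hE : 0 < Real.exp (-(c * s)) := Real.exp_pos _
    have hbase : Real.exp (-(c * s)) * δ ≤ 1 + Real.exp (-(c * s)) * ‖y‖ := by nlinarith
    have h1 : (1 + Real.exp (-(c * s)) * ‖y‖) ^ (-k) ≤ (Real.exp (-(c * s)) * δ) ^ (-k) :=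
      Real.rpow_le_rpow_of_nonpos (by positivity) hbase (by linarith)
    have h2 : (Real.exp (-(c * s)) * δ) ^ (-k) = δ ^ (-k) * Real.exp (k * c * s) := by
      rw [Real.mul_rpow hE.le hδ.le, ← Real.exp_mul, mul_comm]
      congr 2
      ring
    rw [hD', mul_assoc]
    exact mul_le_mul_of_nonneg_left (h1.trans h2.le) hD0
  -- the bound for every `σ < r₁`
  set A : ℝ := Real.exp (C * r₁) * D' with hA
  have hbound : ∀ σ : ℝ, σ < r₁ → ‖curl (u r₁) x₁‖ ≤ A * Real.exp ((k * c - C) * σ) := by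
    intro σ hσ
    have hσT : σ < T₁ := hσ.trans hr₁
    have hpath : ∀ s ∈ uIcc σ r₁,
        ‖fderiv ℝ (u s) (ODE.evolutionMap u σ s (ODE.evolutionMap u r₁ σ x₁))‖ ≤ (fun _ : ℝ => C) s := by
      intro s hs
      rw [uIcc_of_le hσ.le] at hs
      exact hgrad s (lt_of_le_of_lt hs.2 hr₁) _
    have h1 := norm_curl_le_exp_integral_path hcl hK hL hσT hr₁ x₁ (M := fun _ => C) continuousOn_const hpath
    have hsrc : ‖curl (u σ) (ODE.evolutionMap u r₁ σ x₁)‖ ≤ D' * Real.exp (k * c * σ) :=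
      hsteep σ hσT _ (hfar σ hσ.le)
    have hint : |∫ _ in σ..r₁, C| = C * (r₁ - σ) := by
      rw [intervalIntegral.integral_const, smul_eq_mul, abs_of_nonneg (by nlinarith)]
      ring
    calc ‖curl (u r₁) x₁‖
        ≤ Real.exp |∫ _ in σ..r₁, C| * ‖curl (u σ) (ODE.evolutionMap u r₁ σ x₁)‖ := h1
      _ ≤ Real.exp (C * (r₁ - σ)) * (D' * Real.exp (k * c * σ)) := by
          rw [hint]
          exact mul_le_mul_of_nonneg_left hsrc (Real.exp_pos _).le
      _ = A * Real.exp ((k * c - C) * σ) := by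
          rw [hA, show C * (r₁ - σ) = C * r₁ + -(C * σ) by ring, Real.exp_add,
            show (k * c - C) * σ = -(C * σ) + k * c * σ by ring, Real.exp_add]
          ring
  -- let `σ → −∞`
  have hlim : Tendsto (fun σ : ℝ => A * Real.exp ((k * c - C) * σ)) atBot (𝓝 0) := by
    have h1 : Tendsto (fun σ : ℝ => (k * c - C) * σ) atBot atBot := tendsto_id.const_mul_atBot (by linarith)
    have h2 := (Real.tendsto_exp_atBot.comp h1).const_mul A
    simpa using h2
  rw [← norm_le_zero_iff]
  exact ge_of_tendsto hlim ((eventually_lt_atBot r₁).mono fun σ hσ => hbound σ hσ)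

/-- **OFF THE TRAPPED SET THE VORTICITY VANISHES** (steep vorticity, bounded gradient): if `x ∉ T_τ`, some `r₁ ≤ τ` has
`‖φ(r₁, τ, x)‖ > (M/c) e^{c r₁}`; the particle then stays at distance `≥ δ > 0` from the origin before `r₁` (finite displacement,
`FadingPast.norm_evolutionMap_sub_le`), so `ω(r₁, φ(r₁, τ, x)) = 0` (`curl_eq_zero_of_escape`), and the Cauchy formula from `r₁` to `τ`
transports the zero. [folklore] -/
theorem curl_eq_zero_of_not_mem_trapped (hcl : IsClassicalEulerSolutionOn (Iio T₁) 0 u p) (hc : 0 < c)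
    (hvel : ∀ s : ℝ, s < T₁ → ∀ y, ‖u s y‖ ≤ M * Real.exp (c * s))
    (hgrad : ∀ s : ℝ, s < T₁ → ∀ y, ‖fderiv ℝ (u s) y‖ ≤ C)
    (hcurl : ∀ s : ℝ, s < T₁ → ∀ y, ‖curl (u s) y‖ ≤ D * (1 + Real.exp (-(c * s)) * ‖y‖) ^ (-k))
    (hkc : C < k * c) {τ : ℝ} (hτ : τ < T₁) {x : EuclideanSpace ℝ (Fin 3)}
    (hx : x ∉ {x : EuclideanSpace ℝ (Fin 3) | ∀ r : ℝ, r ≤ τ → ‖ODE.evolutionMap u τ r x‖ ≤ M / c * Real.exp (c * r)}) :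
    curl (u τ) x = 0 := by
  -- adapted from …FadingTamePast (`FadingPast.curl_eq_zero_of_not_mem_trapped`)
  obtain ⟨-, K, hK, hL⟩ := lipschitz_and_isUniformlyLipschitzOn hcl hgrad
  simp only [mem_setOf_eq, not_forall, not_le, exists_prop] at hx
  obtain ⟨r₁, hr₁, hbig⟩ := hx
  have hr₁T : r₁ < T₁ := lt_of_le_of_lt hr₁ hτ
  set x₁ := ODE.evolutionMap u τ r₁ x with hx₁
  set δ : ℝ := ‖x₁‖ - M / c * Real.exp (c * r₁) with hδ
  have hδ0 : 0 < δ := by rw [hδ]; linarith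
  have hfar : ∀ r : ℝ, r ≤ r₁ → δ ≤ ‖ODE.evolutionMap u r₁ r x₁‖ := by
    intro r hr
    have h1 := norm_evolutionMap_sub_le hL hc hvel hr₁T hr x₁
    have h2 := norm_sub_norm_le x₁ (ODE.evolutionMap u r₁ r x₁)
    rw [← norm_neg, neg_sub] at h1
    rw [hδ]; linarith
  have hzero : curl (u r₁) x₁ = 0 := curl_eq_zero_of_escape hcl hc hgrad hcurl hkc hr₁T x₁ hδ0 hfar
  exact curl_eq_zero_of_curl_eq_zero_earlier hcl hK hr₁T hτ x hzero

/-- **A CLASSICAL EULER FLOW WITH A FADING PAST, BOUNDED GRADIENT AND STEEP VORTICITY IS IRROTATIONAL**: `‖u(t,y)‖ ≤ M e^{ct}`,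
`‖∇u(t,y)‖ ≤ C`, `‖curl u(t,y)‖ ≤ D(1 + e^{−ct}‖y‖)^{−k}` on `(−∞, T₁)` (`c > 0`, `k c > C`) ⇒ `curl u(τ) ≡ 0` for every `τ < T₁`
(the vorticity vanishes off the closed null trapped set, hence everywhere by continuity). [folklore] -/
theorem curl_eq_zero (hcl : IsClassicalEulerSolutionOn (Iio T₁) 0 u p) (hc : 0 < c)
    (hvel : ∀ s : ℝ, s < T₁ → ∀ y, ‖u s y‖ ≤ M * Real.exp (c * s))
    (hgrad : ∀ s : ℝ, s < T₁ → ∀ y, ‖fderiv ℝ (u s) y‖ ≤ C)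
    (hcurl : ∀ s : ℝ, s < T₁ → ∀ y, ‖curl (u s) y‖ ≤ D * (1 + Real.exp (-(c * s)) * ‖y‖) ^ (-k))
    (hkc : C < k * c) {τ : ℝ} (hτ : τ < T₁) (x : EuclideanSpace ℝ (Fin 3)) : curl (u τ) x = 0 := by
  -- adapted from …FadingTamePast (`FadingPast.curl_eq_zero`)
  obtain ⟨-, K, -, hL⟩ := lipschitz_and_isUniformlyLipschitzOn hcl hgrad
  have hM : 0 ≤ M := by
    have h := hvel τ hτ 0
    exact le_of_mul_le_mul_right ((norm_nonneg _).trans h |> le_trans (by simp)) (Real.exp_pos (c * τ))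
  set T : Set (EuclideanSpace ℝ (Fin 3)) :=
    {x : EuclideanSpace ℝ (Fin 3) | ∀ r : ℝ, r ≤ τ → ‖ODE.evolutionMap u τ r x‖ ≤ M / c * Real.exp (c * r)} with hT
  have hnull : volume T = 0 := volume_trapped_eq_zero hcl hL hc hM hτ
  have hdense : Dense Tᶜ := by
    rw [← interior_eq_empty_iff_dense_compl]
    by_contra hne
    have hpos := (isOpen_interior.measure_pos volume (nonempty_iff_ne_empty.2 hne))
    have hle : volume (interior T) ≤ 0 := hnull ▸ measure_mono interior_subset
    exact absurd (lt_of_lt_of_le hpos hle) (lt_irrefl _)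
  have hcont : Continuous (curl (u τ)) :=
    continuous_curl ((hcl.contDiff_velocity hτ).of_le (by exact_mod_cast le_top))
  have h := Continuous.ext_on hdense hcont continuous_const fun y hy =>
    curl_eq_zero_of_not_mem_trapped hcl hc hvel hgrad hcurl hkc hτ hy
  exact congrFun h x

/-! ### Member level -/

/-- **MEMBERS WITH A FADING PAST, BOUNDED GRADIENT AND STEEP VORTICITY ARE TRIVIAL.**  Crux hypotheses verbatim (`0 < ρ ≤ ½`) +
`(u, p)` classical on a past sub-slab `(−∞, T₁)`, `T₁ ≤ 0`, with `‖u(t,y)‖ ≤ M e^{ct}` (`c > 0`), `‖∇u(t,y)‖ ≤ C` and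
`‖curl u(t,y)‖ ≤ D(1 + e^{−ct}‖y‖)^{−k}`, `k c > C`, there (nothing assumed on `[T₁, 0)`) ⇒ `u = 0` a.e. on `(−∞, 0) × ℝ³`: the past is
classical, incompressible and irrotational (`curl_eq_zero`), and `PastIrrotational.ae_eq_zero_of_gauge_of_pastIrrotational` concludes.
[folklore; LEAD ns-typeII-p2 g10's residue-T3 bite «steep-vorticity breathers / bounded-gradient fading past»] -/
theorem ae_eq_zero_of_gauge_of_fadingSteepVorticityPast {ρ : ℝ} (hρ : 0 < ρ) (hρh : ρ ≤ 1 / 2)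
    {H : ℝ → EuclideanSpace ℝ (Fin 3) → EuclideanSpace ℝ (Fin 3) →L[ℝ] EuclideanSpace ℝ (Fin 3)} {c₀ : ℝ≥0}
    (hsw : IsSuitableWeakSolutionOn (slab (EuclideanSpace ℝ (Fin 3)) (Iio 0) isOpen_Iio) 0 0 u p)
    (hH : HasWeakSpatialGradientOn (slab (EuclideanSpace ℝ (Fin 3)) (Iio 0) isOpen_Iio) u H)
    (hgauge : ∀ a : ℝ, 0 < a →
      ENNReal.ofReal (a ^ (2 * ρ)) * cknA a (0 : ℝ × EuclideanSpace ℝ (Fin 3)) u +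
          ENNReal.ofReal (a ^ ρ) * cknE a (0 : ℝ × EuclideanSpace ℝ (Fin 3)) H +
        ENNReal.ofReal (a ^ (2 * ρ)) * cknD a (0 : ℝ × EuclideanSpace ℝ (Fin 3)) p ≤ (c₀ : ℝ≥0∞))
    (hT₁ : T₁ ≤ 0) (hcl : IsClassicalEulerSolutionOn (Iio T₁) 0 u p) (hc : 0 < c)
    (hvel : ∀ s : ℝ, s < T₁ → ∀ y, ‖u s y‖ ≤ M * Real.exp (c * s))
    (hgrad : ∀ s : ℝ, s < T₁ → ∀ y, ‖fderiv ℝ (u s) y‖ ≤ C)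
    (hcurl : ∀ s : ℝ, s < T₁ → ∀ y, ‖curl (u s) y‖ ≤ D * (1 + Real.exp (-(c * s)) * ‖y‖) ^ (-k))
    (hkc : C < k * c) :
    uncurry u =ᵐ[volume.restrict (Iio (0 : ℝ) ×ˢ (univ : Set (EuclideanSpace ℝ (Fin 3))))] 0 :=
  PastIrrotational.ae_eq_zero_of_gauge_of_pastIrrotational hρ hρh hsw hH hgauge hT₁
    (fun τ hτ => (hcl.contDiff_velocity hτ).of_le (by norm_cast))
    (fun τ hτ => hcl.divFree τ hτ) (fun τ hτ x => curl_eq_zero hcl hc hvel hgrad hcurl hkc hτ x)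

end Fading

end Summit.NavierStokesRegularity.NavierStokesRegularity.Theorems.PowerGaugeEulerLiouville.FadingSteepPast
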